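import Summits.CriticalPhenomena.PercolationContinuityZ3.Theorems.PercNearOneGluingNoHeavyLowerTailSahiHittingFiveBoxData
import HarnessLib

/-!
# `NoHeavyLowerTail` (stmt-CriticalPhenomena-4575) — kernel certificates `E` for the universal order-5 hitting polynomial on `[0,1]³¹`

Support file, seat `prim-l12-p5` (gen 10), `--supports stmt-CriticalPhenomena-4575`.  COMPUTATIONAL: `native_decide` runs of `SahiHitting.boxcheckK`
(pruned recursive Bernstein slicing with the monomial-domination leaf test, `…SahiHittingBoxRecursive`) on the singleton-vertex pre-slices
`p5SliceS s` of `p5K` (`…SahiHittingFiveBoxData`), for the vertices `s` listed below (node counts from the seat engine `code/psplit.py`); assembled in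
`…SahiHittingFiveBox`.  No sorries. [this work]
-/

namespace Summit.CriticalPhenomena.PercolationContinuityZ3.Theorems

namespace SahiHitting

/-- Certificate for the private-region vertex `s = (1, 1, 1, 0, 1)`. [this work] -/
theorem p5_cert_11101 : boxcheckK p5VarsRest (p5SliceS 1 1 1 0 1) = true := by
  native_decide

end SahiHitting

end Summit.CriticalPhenomena.PercolationContinuityZ3.Theorems
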